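import Summits.CriticalPhenomena.PercolationContinuityZ3.Theorems.PercNearOneGluingNoHeavyLowerTailSunflowerMinorInduction
import Summits.CriticalPhenomena.PercolationContinuityZ3.Theorems.PercNearOneGluingNoHeavyLowerTailSunflowerPurePayer
import Summits.CriticalPhenomena.PercolationContinuityZ3.Theorems.PercNearOneGluingNoHeavyLowerTailSunflowerPartitionLemmaBRefutation
import HarnessLib
import HarnessLib.Audit

/-!
# `NoHeavyLowerTail` (crux stmt-CriticalPhenomena-4575), abstract sunflower cubic: the bottom slack IS the Lemma-B slack —
# `BottomSlackPaysRainbows` (★_B) and `MinorSuperadditivity` (DC) are REFUTED (doubled star)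

Support file (seat `prim-l12-p2` gen 21; `--supports stmt-CriticalPhenomena-4575`).  No `sorry`, no definitions, no named facts.
Memo: run/shared/lean/prim/prim-l12/prim-l12-p2/FINDING-g21-BOTTOM-SLACK-IS-LEMMA-B.md.

CORRECTION OF RECORD.  Gen 20 of this seat typed two census-clean conjectures, `BottomSlackPaysRainbows`
(`#rainbows ≤ Σ_{lab S = 0} cubeSlack Sᶜ`, file `…SunflowerBottomSlack`) and its deletion–contraction refinement `MinorSuperadditivity`
(file `…SunflowerMinorInduction`), with the reductions (DC) ⇒ (★_B) ⇒ ★ (`PartitionLemmaH`).  Both are FALSE: grouping the antipodal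
Gladkov sum of a cube by the kernel `kk = [⊤|0] + [0|⊤] − [i|j, i ≠ j]` gives

* `Sunflower.sum_kk_eq_two_cubeSlack` : `Σ_{T ⊆ U} kk (lab T) (lab (U∖T)) = 2·cubeSlack U` (both orders of every antipodal pair);
* `Sunflower.SA_eq_two_sum_cubeSlack`, `Sunflower.SB_eq_two_sum_cubeSlack` : the spectator surpluses of `…SunflowerPurePayer` are
  `SA = 2·Σ_{lab S = 4} cubeSlack Sᶜ`, `SB = 2·Σ_{lab S = 0} cubeSlack Sᶜ`;
* `Sunflower.ZA_eq_six_sum_cubeSlack`, **`Sunflower.ZB_eq_six_bottomSlack`** : `ZB = 6·(Σ_{lab S = 0} cubeSlack Sᶜ − #rainbows)`,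
  i.e. the quantity of (★_B) is EXACTLY prove-1 g25's Lemma-B slack `ZB/6` (`3·SB − Ntri = 6(NBB − ND)` in `…SunflowerCoreCounts`);
* `bottomSlackPaysRainbows_iff_partitionLemmaB` : (★_B) ⟺ `PartitionLemmaB`;
* **`not_bottomSlackPaysRainbows`**, **`not_minorSuperadditivity`** : both conjectures fail — by `not_partitionLemmaB`
  (`…SunflowerPartitionLemmaBRefutation`, this seat gen 5: the DOUBLED STAR on `Fin 6`, `ZB = −6`, i.e. bottom slack `7 < 8` rainbows) and the
  landed reduction `bottomSlackPaysRainbows_of_minorSuperadditivity`;  `exists_minorSlack_univ_neg` : a sunflower on `Fin 6` with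
  `minorSlack univ ∅ = −1` (numerically, (DC) fails at the top minor of the doubled star for every `x`: `−1 < 5 + 0`).

The gen-20 censuses were correct but too small: Lemma B first fails on 6 points (doubled star; the exhaustive pass stopped at 5 points and the
6/7-point samples missed the clone families).  What SURVIVES of gen 20 (all unconditional theorems): the cube-by-cube form
`ZH = 6(Σ_B cubeSlack + Σ_A cubeSlack − #rainbows)`, (★_B) and `RainbowKernelIndependence` for an INTERSECTING petal 1, the complement reading
lemma, and the minor identities at dominant / petal points (now statements about the Lemma-B slack `ZB/6` of minors, true but no longer on a
road to ★).  The open core of ★ is unchanged since gen 17: sunflowers all of whose petals are non-intersecting, where the KERNEL-spectator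
slack `Σ_{lab S = 4} cubeSlack Sᶜ = SA/2` must pay (on the doubled star it pays `8` for a bottom deficit of `1`).
-/

namespace Summit.CriticalPhenomena.PercolationContinuityZ3.Theorems.SunflowerPartition

open Finset

namespace Sunflower

variable {α : Type*} [Fintype α] [DecidableEq α] (F : Sunflower α)

omit [Fintype α] in
/-- The {top | bottom} antipodal pairs of a cube listed by the TOP side are as many as listed by the bottom side (`abCard`):
complementation inside the cube. [this work] -/
theorem card_filter_top_bottom_eq_abCard (U : Finset α) :
    (U.powerset.filter fun T => F.lab T = 4 ∧ F.lab (U \ T) = 0).card = F.abCard U := by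
  unfold abCard
  refine Finset.card_bij' (fun T _ => U \ T) (fun O _ => U \ O) ?_ ?_ ?_ ?_
  · intro T hT
    obtain ⟨hTU, h4, h0⟩ := mem_filter.1 hT
    refine mem_filter.2 ⟨mem_powerset.2 sdiff_subset, h0, ?_⟩
    rw [Finset.sdiff_sdiff_eq_self (mem_powerset.1 hTU)]; exact h4
  · intro O hO
    obtain ⟨hOU, h0, h4⟩ := mem_filter.1 hO
    refine mem_filter.2 ⟨mem_powerset.2 sdiff_subset, h4, ?_⟩
    rw [Finset.sdiff_sdiff_eq_self (mem_powerset.1 hOU)]; exact h0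
  · intro T hT; exact Finset.sdiff_sdiff_eq_self (mem_powerset.1 (mem_filter.1 hT).1)
  · intro O hO; exact Finset.sdiff_sdiff_eq_self (mem_powerset.1 (mem_filter.1 hO).1)

omit [Fintype α] in
/-- The antipodal pairs of a cube labelled by two DISTINCT petals, listed by either side, are twice the cross pairs `crCard`
(listed by the larger-label side). [this work] -/
theorem card_filter_distinctPetals_eq_two_crCard (U : Finset α) :
    (U.powerset.filter fun T => F.lab T ≠ 0 ∧ F.lab T ≠ 4 ∧ F.lab (U \ T) ≠ 0 ∧ F.lab (U \ T) ≠ 4 ∧ F.lab T ≠ F.lab (U \ T)).card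
      = 2 * F.crCard U := by
  set s := U.powerset.filter fun T => F.lab T ≠ 0 ∧ F.lab T ≠ 4 ∧ F.lab (U \ T) ≠ 0 ∧ F.lab (U \ T) ≠ 4 ∧ F.lab T ≠ F.lab (U \ T)
    with hs
  rw [← Finset.card_filter_add_card_filter_not (s := s) (p := fun T => F.lab (U \ T) < F.lab T)]
  have h1 : (s.filter fun T => F.lab (U \ T) < F.lab T).card = F.crCard U := by
    unfold crCard
    congr 1
    ext T
    simp only [hs, mem_filter, mem_powerset]
    constructor
    · rintro ⟨⟨hTU, h0, h4, h0', h4', -⟩, hlt⟩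
      exact ⟨hTU, h0, h4, h0', h4', hlt⟩
    · rintro ⟨hTU, h0, h4, h0', h4', hlt⟩
      exact ⟨⟨hTU, h0, h4, h0', h4', (ne_of_lt hlt).symm⟩, hlt⟩
  have h2 : (s.filter fun T => ¬ F.lab (U \ T) < F.lab T).card = F.crCard U := by
    unfold crCard
    refine Finset.card_bij' (fun T _ => U \ T) (fun Y _ => U \ Y) ?_ ?_ ?_ ?_
    · intro T hT
      rw [mem_filter, hs, mem_filter, mem_powerset] at hT
      obtain ⟨⟨hTU, h0, h4, h0', h4', hne⟩, hnlt⟩ := hT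
      have hlt : F.lab T < F.lab (U \ T) := lt_of_le_of_ne (not_lt.1 hnlt) hne
      refine mem_filter.2 ⟨mem_powerset.2 sdiff_subset, h0', h4', ?_, ?_, ?_⟩
      · rw [Finset.sdiff_sdiff_eq_self hTU]; exact h0
      · rw [Finset.sdiff_sdiff_eq_self hTU]; exact h4
      · rw [Finset.sdiff_sdiff_eq_self hTU]; exact hlt
    · intro Y hY
      obtain ⟨hYU, h0, h4, h0', h4', hlt⟩ := mem_filter.1 hY
      have hYU' := mem_powerset.1 hYU
      rw [mem_filter, hs, mem_filter, mem_powerset]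
      refine ⟨⟨sdiff_subset, h0', h4', ?_, ?_, ?_⟩, ?_⟩
      · rw [Finset.sdiff_sdiff_eq_self hYU']; exact h0
      · rw [Finset.sdiff_sdiff_eq_self hYU']; exact h4
      · rw [Finset.sdiff_sdiff_eq_self hYU']; exact ne_of_lt hlt
      · rw [Finset.sdiff_sdiff_eq_self hYU']; exact not_lt.2 (le_of_lt hlt)
    · intro T hT
      rw [mem_filter, hs, mem_filter, mem_powerset] at hT
      exact Finset.sdiff_sdiff_eq_self hT.1.1
    · intro Y hY; exact Finset.sdiff_sdiff_eq_self (mem_powerset.1 (mem_filter.1 hY).1)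
  rw [h1, h2]; ring

omit [Fintype α] in
/-- **The antipodal Gladkov sum of a cube is twice its Gladkov slack**: `Σ_{T ⊆ U} kk (lab T) (lab (U∖T)) = 2·(#AB(U) − #CR(U))`. [this work] -/
theorem sum_kk_eq_two_cubeSlack (U : Finset α) :
    ∑ T ∈ U.powerset, kk (F.lab T) (F.lab (U \ T)) = 2 * F.cubeSlack U := by
  have h : ∑ T ∈ U.powerset, kk (F.lab T) (F.lab (U \ T))
      = ((U.powerset.filter fun T => F.lab T = 4 ∧ F.lab (U \ T) = 0).card : ℤ)
        + ((U.powerset.filter fun T => F.lab T = 0 ∧ F.lab (U \ T) = 4).card : ℤ)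
        - ((U.powerset.filter fun T => F.lab T ≠ 0 ∧ F.lab T ≠ 4 ∧ F.lab (U \ T) ≠ 0 ∧ F.lab (U \ T) ≠ 4 ∧
            F.lab T ≠ F.lab (U \ T)).card : ℤ) := by
    simp only [kk_eq_ite, sum_sub_distrib, sum_add_distrib, sum_boole]
  rw [h, F.card_filter_top_bottom_eq_abCard, F.card_filter_distinctPetals_eq_two_crCard]
  unfold cubeSlack abCard
  push_cast
  ring

/-- A spectator surplus with an indicator weight is twice the total Gladkov slack of the cubes complementary to the selected spectator
blocks. [this work] -/
theorem Sw_indicator_eq_two_sum_cubeSlack (v : Fin 5) :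
    F.Sw (fun u => if u = v then 1 else 0) = 2 * ∑ S ∈ (univ : Finset (Finset α)).filter (fun S => F.lab S = v), F.cubeSlack Sᶜ := by
  unfold Sw
  rw [sum_parts_eq (f := fun S T => (if F.lab S = v then (1 : ℤ) else 0) * kk (F.lab T) (F.lab (S ∪ T)ᶜ))]
  rw [sum_filter, mul_sum]
  refine sum_congr rfl fun S _ => ?_
  split_ifs with hS
  · rw [← F.sum_kk_eq_two_cubeSlack Sᶜ]
    refine sum_congr rfl fun T _ => ?_
    rw [one_mul, compl_union, sdiff_eq_inter_compl]
  · simp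

/-- **`SA = 2·Σ_{lab S = 4} cubeSlack Sᶜ`** (kernel spectators). [this work] -/
theorem SA_eq_two_sum_cubeSlack :
    F.SA = 2 * ∑ S ∈ (univ : Finset (Finset α)).filter (fun S => F.lab S = 4), F.cubeSlack Sᶜ :=
  F.Sw_indicator_eq_two_sum_cubeSlack 4

/-- **`SB = 2·Σ_{lab S = 0} cubeSlack Sᶜ`** (bottom spectators). [this work] -/
theorem SB_eq_two_sum_cubeSlack :
    F.SB = 2 * ∑ S ∈ (univ : Finset (Finset α)).filter (fun S => F.lab S = 0), F.cubeSlack Sᶜ :=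
  F.Sw_indicator_eq_two_sum_cubeSlack 0

/-- `ZA = 6·Σ_{lab S = 4} cubeSlack Sᶜ`. [this work] -/
theorem ZA_eq_six_sum_cubeSlack :
    F.ZA = 6 * ∑ S ∈ (univ : Finset (Finset α)).filter (fun S => F.lab S = 4), F.cubeSlack Sᶜ := by
  rw [F.ZA_eq_three_mul_SA, F.SA_eq_two_sum_cubeSlack]; ring

/-- **THE BOTTOM SLACK IS THE LEMMA-B SLACK**: `ZB = 6·(Σ_{lab S = 0} cubeSlack Sᶜ − #rainbows)`. [this work] -/
theorem ZB_eq_six_bottomSlack :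
    F.ZB = 6 * ((∑ S ∈ (univ : Finset (Finset α)).filter (fun S => F.lab S = 0), F.cubeSlack Sᶜ) - (F.rainbowCard : ℤ)) := by
  have h := F.ZH_eq_ZA_add_ZB
  rw [F.ZH_eq_six_slack, F.ZA_eq_six_sum_cubeSlack] at h
  linarith

/-- `ZB = 6·minorSlack univ ∅` (the top minor's bottom slack of `…SunflowerMinorInduction`). [this work] -/
theorem ZB_eq_six_minorSlack_univ : F.ZB = 6 * F.minorSlack univ ∅ := by
  rw [F.minorSlack_univ_empty, F.ZB_eq_six_bottomSlack]

end Sunflower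

/-- **(★_B) ⟺ Lemma B.** [this work] -/
theorem bottomSlackPaysRainbows_iff_partitionLemmaB : BottomSlackPaysRainbows ↔ PartitionLemmaB := by
  constructor
  · intro h α _ _ F
    have hF := h α F
    rw [F.ZB_eq_six_bottomSlack]
    linarith
  · intro h α _ _ F
    have hF := h α F
    rw [F.ZB_eq_six_bottomSlack] at hF
    linarith

/-- **`BottomSlackPaysRainbows` IS FALSE** (the doubled star: bottom slack `7`, rainbows `8`). [this work] -/
theorem not_bottomSlackPaysRainbows : ¬ BottomSlackPaysRainbows := fun h =>
  not_partitionLemmaB (bottomSlackPaysRainbows_iff_partitionLemmaB.1 h)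

/-- **`MinorSuperadditivity` IS FALSE** (it implies (★_B), `bottomSlackPaysRainbows_of_minorSuperadditivity`). [this work] -/
theorem not_minorSuperadditivity : ¬ MinorSuperadditivity := fun h =>
  not_bottomSlackPaysRainbows (bottomSlackPaysRainbows_of_minorSuperadditivity h)

/-- A sunflower on six points whose top minor has NEGATIVE bottom slack (`minorSlack univ ∅ = −1`: the doubled star). [this work] -/
theorem exists_minorSlack_univ_neg : ∃ F : Sunflower (Fin 6), F.minorSlack univ ∅ = -1 := by
  obtain ⟨F, hF⟩ := exists_sunflower_ZB_neg
  refine ⟨F, ?_⟩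
  have h := F.ZB_eq_six_minorSlack_univ
  rw [hF] at h
  linarith

end Summit.CriticalPhenomena.PercolationContinuityZ3.Theorems.SunflowerPartition
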